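import Mathlib
import Summits.NavierStokesRegularity.NavierStokesRegularity.Theorems.EulerZoomLiouvillePowerGaugeEulerLiouvilleEnergySaturationMember
import Summits.NavierStokesRegularity.NavierStokesRegularity.Theorems.EulerZoomLiouvillePowerGaugeEulerLiouvilleSelfSimilarPastSubExtremal
import HarnessLib

/-!
# The `L^p`-profile stratum of the crux `EulerZoomLiouville.PowerGaugeEulerLiouville` (weak class):
# the easy side of Chae–Shvydkoy's `L^p` window inside Seregin's class

Route №10 `EulerZoomLiouville` (NavierStokesRegularity), crux E = stmt-NavierStokesRegularity-19832,
registered open stub `stub_selfSimilarWeakRest` (the genuinely weak exactly self-similar members).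
Chae–Shvydkoy (ARMA 209 (2013) = arXiv:1201.6009, Thm 3.2) exclude `C²` self-similar Euler collapse
profiles `v ∈ L^p(ℝ³)` for `−1 < α ≤ 3/p` (and `α > 3/2`); the window `3/p < α ≤ 3/2` is open.  In
the crux's exponents `α = 1 + ρ`, `γ = 1/(2+ρ)`, so `α ≤ 3/p` reads `p ≤ 3/(1+ρ)`.

Inside Seregin's power-gauged class the easy side `p ≤ 3/(1+ρ)` needs NO regularity and NO profile
equation: it is Hölder's inequality plus the lineage's SUB-EXTREMAL dichotomy
(`EnergySaturation.selfSimilar_ae_eq_zero_of_subExtremal`, the weak-class Bronzi–Shvydkoy energy law).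
For `0 < ρ < 1/2`, `2 ≤ p ≤ 3/(1+ρ)` and a velocity profile `V ∈ L²_loc` which is `L^p` NEAR INFINITY
(`V ∈ L^p({|y| ≥ R₀})`):
`∫_{B_L ∩ {|y| ≥ R}} |V|² ≤ ‖V‖²_{L^p(|y| ≥ R)} · |B_L|^{1−2/p}` and `|B_L|^{1−2/p} = |B₁|^{1−2/p} L^{3(1−2/p)}`
with `3(1 − 2/p) ≤ 1 − 2ρ ⟺ p(1+ρ) ≤ 3`; choosing first `R` with `‖V‖_{L^p(|y| ≥ R)}` small (tail of an
`L^p` function) and then `L` large (`L^{2ρ−1} ∫_{B_R}|V|² → 0` as `ρ < 1/2`), the normalised energy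
`L^{2ρ−1} ∫_{B_L}|V|²` becomes smaller than any `ε > 0` beyond any `L₀`: the profile is SUB-EXTREMAL.

* `LpProfile.subExtremal_of_memLp` — the profile-level lemma just described (pure measure theory);
* `LpProfile.selfSimilar_ae_eq_zero_of_memLp_profile` — crux hypotheses verbatim + exact
  self-similarity about the origin + `V ∈ L^p` near infinity, `2 ≤ p ≤ 3/(1+ρ)`, `0 < ρ < 1/2`
  ⇒ the member is trivial (`EnergySaturation.selfSimilar_ae_eq_zero_of_subExtremal`);
* `LpProfile.selfSimilar_ae_eq_zero_of_memLp_profile_past` — the same for members exactly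
  self-similar about any `(T, x₀)` on a past sub-slab `(−∞, T₁)` (`T₁ ≤ 0`, `T₁ ≤ T`), via the
  large-scale chain `Past.selfSimilar_ae_eq_zero_of_subExtremal_past`;
* `…_of_memLp_profile'` / `…_past'` — the forms with a GLOBAL hypothesis `V ∈ L^p(ℝ³)`.

At the endpoint `ρ = 1/2` the only admissible exponent is `p = 2 = 3/(1+ρ)`, where the normalising
power `L^{2ρ−1}` is `L⁰` and sub-extremality fails for every nonzero `L²` profile; there `V ∈ L²` is
automatic (`A`-gauge) and the endpoint is the open Chae–Shvydkoy endpoint (tree: the power-spread /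
shell-drain files).  So the stratum is `ρ < 1/2` only.

WHAT THIS IS NOT: not NS, not E, not the stub — a weak-class stratum lemma: the OPEN side
`p > 3/(1+ρ)` of the `L^p` window (extremal weak profiles) is untouched. [cite: ChaeShvydkoy2013, §3.2 Thm. 3.2]
-/

noncomputable section

-- flat `Theorems/<Route><Decl>…` files of one crux share the namespace of the crux (tree convention)
set_option linter.dupNamespace false

open MeasureTheory Set Filter Topology Metric Function TopologicalSpace
open scoped ENNReal NNReal

namespace Summit.NavierStokesRegularity.NavierStokesRegularity.Theorems.PowerGaugeEulerLiouville

open Literature.Analysis Literature.Analysis.FunctionSpaces Literature.Analysis.FluidPDE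

namespace LpProfile

section Profile

variable {V : EuclideanSpace ℝ (Fin 3) → EuclideanSpace ℝ (Fin 3)}

/-- The tail of an `L^p` function near infinity: if `∫_{|y| ≥ R₀} ‖V‖^p < ∞` then
`∫_{|y| ≥ R} ‖V‖^p → 0` as `R → ∞` (continuity of the measure `‖V‖ₑ^p dy` from above along the
exteriors of balls, whose intersection is empty). [folklore] -/
theorem tendsto_lintegral_exterior_rpow_enorm {p R₀ : ℝ}
    (hfin : ∫⁻ y in {y : EuclideanSpace ℝ (Fin 3) | R₀ ≤ ‖y‖}, ‖V y‖ₑ ^ p < ⊤) :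
    Tendsto (fun R : ℝ => ∫⁻ y in {y : EuclideanSpace ℝ (Fin 3) | R ≤ ‖y‖}, ‖V y‖ₑ ^ p)
      atTop (𝓝 0) := by
  set S : ℝ → Set (EuclideanSpace ℝ (Fin 3)) := fun R => {y | R ≤ ‖y‖} with hS
  have hSm : ∀ R, MeasurableSet (S R) := fun R =>
    measurableSet_le measurable_const measurable_norm
  have hanti : Antitone S := fun R R' hRR' y (hy : R' ≤ ‖y‖) => le_trans hRR' hy
  set ν : Measure (EuclideanSpace ℝ (Fin 3)) := volume.withDensity fun y => ‖V y‖ₑ ^ p with hν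
  have hνS : ∀ R, ν (S R) = ∫⁻ y in S R, ‖V y‖ₑ ^ p := fun R => withDensity_apply _ (hSm R)
  have hinter : (⋂ R : ℝ, S R) = ∅ := by
    ext y
    simp only [mem_iInter, mem_empty_iff_false, iff_false, not_forall]
    exact ⟨‖y‖ + 1, fun h : ‖y‖ + 1 ≤ ‖y‖ => by linarith⟩
  have hlim := tendsto_measure_iInter_atTop (μ := ν) (fun R => (hSm R).nullMeasurableSet) hanti
    ⟨R₀, by rw [hνS]; exact hfin.ne⟩
  rw [hinter, measure_empty] at hlim
  refine hlim.congr fun R => ?_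
  exact hνS R

/-- **Hölder on the exterior part of a ball**: for `2 ≤ p` and measurable `V`,
`∫_{B_L ∩ {|y| ≥ R}} ‖V‖² ≤ (∫_{|y| ≥ R} ‖V‖^p)^{2/p} · |B_L|^{1−2/p}` (in `ℝ≥0∞`). [folklore] -/
theorem lintegral_ball_inter_exterior_sq_le (hVm : AEStronglyMeasurable V volume) {p : ℝ}
    (hp2 : 2 ≤ p) (L R : ℝ) :
    ∫⁻ y in ball (0 : EuclideanSpace ℝ (Fin 3)) L ∩ {y | R ≤ ‖y‖}, ‖V y‖ₑ ^ 2 ≤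
      (∫⁻ y in {y : EuclideanSpace ℝ (Fin 3) | R ≤ ‖y‖}, ‖V y‖ₑ ^ p) ^ (2 / p) *
        volume (ball (0 : EuclideanSpace ℝ (Fin 3)) L) ^ (1 - 2 / p) := by
  set A : Set (EuclideanSpace ℝ (Fin 3)) := ball 0 L ∩ {y | R ≤ ‖y‖} with hA
  have hp0 : 0 < p := by linarith
  -- Hölder / comparison of exponents on the finite piece `A`
  have hcmp := eLpNorm'_le_eLpNorm'_mul_rpow_measure_univ (μ := volume.restrict A) (f := V)
    two_pos hp2 hVm.restrict
  rw [eLpNorm'_eq_lintegral_enorm, eLpNorm'_eq_lintegral_enorm, Measure.restrict_apply_univ] at hcmp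
  -- square both sides
  have hsq := pow_le_pow_left' hcmp 2
  have e1 : ((∫⁻ y in A, ‖V y‖ₑ ^ (2 : ℝ)) ^ (1 / (2 : ℝ))) ^ 2 = ∫⁻ y in A, ‖V y‖ₑ ^ 2 := by
    rw [← ENNReal.rpow_natCast, ← ENNReal.rpow_mul]
    norm_num
  have e2 : ((∫⁻ y in A, ‖V y‖ₑ ^ p) ^ (1 / p) * volume A ^ (1 / (2 : ℝ) - 1 / p)) ^ 2 =
      (∫⁻ y in A, ‖V y‖ₑ ^ p) ^ (2 / p) * volume A ^ (1 - 2 / p) := by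
    rw [mul_pow, ← ENNReal.rpow_natCast ((∫⁻ y in A, ‖V y‖ₑ ^ p) ^ (1 / p)), ← ENNReal.rpow_mul,
      ← ENNReal.rpow_natCast (volume A ^ (1 / (2 : ℝ) - 1 / p)), ← ENNReal.rpow_mul]
    congr 2 <;> push_cast <;> ring
  rw [e1, e2] at hsq
  refine hsq.trans ?_
  have h2p : 0 ≤ 2 / p := by positivity
  have h12p : 0 ≤ 1 - 2 / p := by
    rw [sub_nonneg, div_le_one hp0]; exact hp2
  exact mul_le_mul' (ENNReal.rpow_le_rpow (lintegral_mono_set inter_subset_right) h2p)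
    (ENNReal.rpow_le_rpow (measure_mono inter_subset_left) h12p)

/-- Volume scaling of balls in `ℝ³`, with a real exponent: `|B_L|^θ = ofReal (L^{3θ}) · |B₁|^θ`
(`L > 0`, `θ ≥ 0`). [folklore] -/
theorem volume_ball_rpow (θ : ℝ) (hθ : 0 ≤ θ) {L : ℝ} (hL : 0 < L) :
    volume (ball (0 : EuclideanSpace ℝ (Fin 3)) L) ^ θ =
      ENNReal.ofReal (L ^ (3 * θ)) * volume (ball (0 : EuclideanSpace ℝ (Fin 3)) 1) ^ θ := by
  rw [Measure.addHaar_ball_of_pos volume (0 : EuclideanSpace ℝ (Fin 3)) hL, finrank_euclideanSpace_fin,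
    ENNReal.mul_rpow_of_nonneg _ _ hθ, ENNReal.ofReal_rpow_of_pos (pow_pos hL 3)]
  congr 2
  rw [← Real.rpow_natCast, ← Real.rpow_mul hL.le]
  norm_num

/-- The real ball energy through the `ℝ≥0∞` one: `∫_{B_L} ‖V‖² = (∫⁻_{B_L} ‖V‖ₑ²).toReal` for
`|V|² ∈ L¹_loc`. [folklore] -/
theorem integral_ball_sq_eq_toReal (hV2 : LocallyIntegrable (fun y => ‖V y‖ ^ 2) volume) (L : ℝ) :
    ∫ y in ball (0 : EuclideanSpace ℝ (Fin 3)) L, ‖V y‖ ^ 2 =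
      (∫⁻ y in ball (0 : EuclideanSpace ℝ (Fin 3)) L, ‖V y‖ₑ ^ 2).toReal := by
  have hI : IntegrableOn (fun y => ‖V y‖ ^ 2) (ball (0 : EuclideanSpace ℝ (Fin 3)) L) volume :=
    (hV2.integrableOn_isCompact (isCompact_closedBall (0 : EuclideanSpace ℝ (Fin 3)) L)).mono_set
      ball_subset_closedBall
  rw [integral_eq_lintegral_of_nonneg_ae (Eventually.of_forall fun y => sq_nonneg _)
    hI.aestronglyMeasurable]
  congr 1
  exact lintegral_congr fun y => by rw [← ofReal_norm, ENNReal.ofReal_pow (norm_nonneg _)]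

/-- Finiteness of the `ℝ≥0∞` ball energy for `|V|² ∈ L¹_loc`. [folklore] -/
theorem lintegral_ball_sq_lt_top (hV2 : LocallyIntegrable (fun y => ‖V y‖ ^ 2) volume) (L : ℝ) :
    ∫⁻ y in ball (0 : EuclideanSpace ℝ (Fin 3)) L, ‖V y‖ₑ ^ 2 < ⊤ := by
  have hI : IntegrableOn (fun y => ‖V y‖ ^ 2) (ball (0 : EuclideanSpace ℝ (Fin 3)) L) volume :=
    (hV2.integrableOn_isCompact (isCompact_closedBall (0 : EuclideanSpace ℝ (Fin 3)) L)).mono_set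
      ball_subset_closedBall
  have h := hI.2
  rw [hasFiniteIntegral_iff_enorm] at h
  refine lt_of_le_of_lt (le_of_eq (lintegral_congr fun y => ?_)) h
  rw [Real.enorm_eq_ofReal (sq_nonneg _), ENNReal.ofReal_pow (norm_nonneg _), ofReal_norm]

/-- **The `L^p`-profile lemma (the easy side of Chae–Shvydkoy's `L^p` window, weak class).**
Let `0 < ρ < 1/2`, `2 ≤ p ≤ 3/(1+ρ)`, and let `V : ℝ³ → ℝ³` be measurable with `|V|² ∈ L¹_loc` and
`V ∈ L^p({|y| ≥ R₀})` for some `R₀`.  Then the profile is SUB-EXTREMAL in the sense of the crux's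
skeleton: for every `ε > 0` and every `L₀` there is `L ≥ L₀` with `L^{2ρ−1} ∫_{B_L} ‖V‖² < ε`
(indeed the normalised energy tends to `0`).  Hölder on `B_L ∩ {|y| ≥ R}` with
`3(1 − 2/p) ≤ 1 − 2ρ`, the `L^p` tail at a large `R`, then `L^{2ρ−1} ∫_{B_R}‖V‖² → 0`.  No profile
equation, no regularity. [cite: ChaeShvydkoy2013, §3.2 Thm. 3.2 (range `α ≤ N/p`)] -/
theorem subExtremal_of_memLp {ρ p R₀ : ℝ} (hρ : 0 < ρ) (hρ2 : ρ < 1 / 2) (hp2 : 2 ≤ p)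
    (hp : p ≤ 3 / (1 + ρ)) (hVm : AEStronglyMeasurable V volume)
    (hV2 : LocallyIntegrable (fun y => ‖V y‖ ^ 2) volume)
    (hVp : MemLp V (ENNReal.ofReal p) (volume.restrict {y : EuclideanSpace ℝ (Fin 3) | R₀ ≤ ‖y‖})) :
    ∀ ε : ℝ, 0 < ε → ∀ L₀ : ℝ, ∃ L : ℝ, L₀ ≤ L ∧
      L ^ (2 * ρ - 1) * ∫ y in ball (0 : EuclideanSpace ℝ (Fin 3)) L, ‖V y‖ ^ 2 < ε := by
  intro ε hε L₀
  have hp0 : 0 < p := by linarith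
  have h2p : 0 < 2 / p := by positivity
  have h12p : 0 ≤ 1 - 2 / p := by rw [sub_nonneg, div_le_one hp0]; exact hp2
  -- the exponent comparison `3 (1 - 2/p) ≤ 1 - 2ρ`
  have hexp : 3 * (1 - 2 / p) ≤ 1 - 2 * ρ := by
    have h1ρ : (0 : ℝ) < 1 + ρ := by linarith
    have hp' : p * (1 + ρ) ≤ 3 := by rwa [le_div_iff₀ h1ρ] at hp
    have : 3 * (1 - 2 / p) = (3 * p - 6) / p := by field_simp; ring
    rw [this, div_le_iff₀ hp0]
    nlinarith
  -- the `L^p` tail near infinity is finite, hence tends to `0`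
  have hpne : ENNReal.ofReal p ≠ 0 := (ENNReal.ofReal_pos.2 hp0).ne'
  have hfin : ∫⁻ y in {y : EuclideanSpace ℝ (Fin 3) | R₀ ≤ ‖y‖}, ‖V y‖ₑ ^ p < ⊤ := by
    have h := lintegral_rpow_enorm_lt_top_of_eLpNorm_lt_top hpne ENNReal.ofReal_ne_top
      hVp.eLpNorm_lt_top
    rwa [ENNReal.toReal_ofReal hp0.le] at h
  have htail := tendsto_lintegral_exterior_rpow_enorm hfin
  -- the constant `|B₁|^{1-2/p}` is finite
  set v₁ : ℝ≥0∞ := volume (ball (0 : EuclideanSpace ℝ (Fin 3)) 1) ^ (1 - 2 / p) with hv₁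
  have hv₁top : v₁ ≠ ⊤ := ENNReal.rpow_ne_top_of_nonneg h12p measure_ball_lt_top.ne
  -- `T(R)^{2/p} · v₁ → 0`; choose `R ≥ R₀` with `T(R)^{2/p} · v₁ < ε/2`
  have hY : Tendsto (fun R : ℝ =>
      (∫⁻ y in {y : EuclideanSpace ℝ (Fin 3) | R ≤ ‖y‖}, ‖V y‖ₑ ^ p) ^ (2 / p) * v₁) atTop (𝓝 0) := by
    have h1 : Tendsto (fun R : ℝ =>
        (∫⁻ y in {y : EuclideanSpace ℝ (Fin 3) | R ≤ ‖y‖}, ‖V y‖ₑ ^ p) ^ (2 / p)) atTop (𝓝 0) := by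
      have hc := (ENNReal.continuous_rpow_const (y := 2 / p)).tendsto (0 : ℝ≥0∞)
      rw [ENNReal.zero_rpow_of_pos h2p] at hc
      exact hc.comp htail
    have h2 := ENNReal.Tendsto.mul_const h1 (Or.inr hv₁top)
    rwa [zero_mul] at h2
  have hε2 : (0 : ℝ≥0∞) < ENNReal.ofReal (ε / 2) := ENNReal.ofReal_pos.2 (by linarith)
  obtain ⟨R, hRY, -⟩ := ((hY.eventually (gt_mem_nhds hε2)).and (eventually_ge_atTop R₀)).exists
  set Y : ℝ≥0∞ := (∫⁻ y in {y : EuclideanSpace ℝ (Fin 3) | R ≤ ‖y‖}, ‖V y‖ₑ ^ p) ^ (2 / p) * v₁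
    with hYdef
  have hYtop : Y ≠ ⊤ := (lt_trans hRY ENNReal.ofReal_lt_top).ne
  have hYreal : Y.toReal < ε / 2 := (ENNReal.lt_ofReal_iff_toReal_lt hYtop).1 hRY
  -- the inner energy `X = ∫⁻_{B_R} ‖V‖²` is finite and `L^{2ρ-1} X → 0`
  set X : ℝ≥0∞ := ∫⁻ y in ball (0 : EuclideanSpace ℝ (Fin 3)) R, ‖V y‖ₑ ^ 2 with hXdef
  have hXtop : X ≠ ⊤ := (lintegral_ball_sq_lt_top hV2 R).ne
  have hXlim : Tendsto (fun L : ℝ => L ^ (2 * ρ - 1) * (X.toReal + 1)) atTop (𝓝 (0 * (X.toReal + 1))) := by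
    refine Tendsto.mul_const _ ?_
    have := tendsto_rpow_neg_atTop (y := 1 - 2 * ρ) (by linarith)
    simpa [show -(1 - 2 * ρ) = 2 * ρ - 1 by ring] using this
  rw [zero_mul] at hXlim
  have hε2' : (0 : ℝ) < ε / 2 := by linarith
  obtain ⟨L, hLX, hLge⟩ :=
    ((hXlim.eventually (gt_mem_nhds hε2')).and (eventually_ge_atTop (max L₀ 1))).exists
  have hL1 : 1 ≤ L := (le_max_right _ _).trans hLge
  have hL0 : 0 < L := one_pos.trans_le hL1
  refine ⟨L, (le_max_left _ _).trans hLge, ?_⟩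
  -- the split `B_L ⊆ B_R ∪ (B_L ∩ {|y| ≥ R})` and Hölder on the second piece
  have hsplit : ∫⁻ y in ball (0 : EuclideanSpace ℝ (Fin 3)) L, ‖V y‖ₑ ^ 2 ≤
      X + Y * ENNReal.ofReal (L ^ (1 - 2 * ρ)) := by
    have hsub : ball (0 : EuclideanSpace ℝ (Fin 3)) L ⊆
        ball 0 R ∪ (ball 0 L ∩ {y | R ≤ ‖y‖}) := by
      intro y hy
      by_cases hyR : ‖y‖ < R
      · exact Or.inl (by rw [mem_ball, dist_zero_right]; exact hyR)
      · exact Or.inr ⟨hy, not_lt.1 hyR⟩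
    calc ∫⁻ y in ball (0 : EuclideanSpace ℝ (Fin 3)) L, ‖V y‖ₑ ^ 2
        ≤ ∫⁻ y in ball 0 R ∪ (ball 0 L ∩ {y | R ≤ ‖y‖}), ‖V y‖ₑ ^ 2 := lintegral_mono_set hsub
      _ ≤ X + ∫⁻ y in ball (0 : EuclideanSpace ℝ (Fin 3)) L ∩ {y | R ≤ ‖y‖}, ‖V y‖ₑ ^ 2 :=
          lintegral_union_le _ _ _
      _ ≤ X + (∫⁻ y in {y : EuclideanSpace ℝ (Fin 3) | R ≤ ‖y‖}, ‖V y‖ₑ ^ p) ^ (2 / p) *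
            volume (ball (0 : EuclideanSpace ℝ (Fin 3)) L) ^ (1 - 2 / p) := by
          gcongr
          exact lintegral_ball_inter_exterior_sq_le hVm hp2 L R
      _ = X + Y * ENNReal.ofReal (L ^ (3 * (1 - 2 / p))) := by
          rw [volume_ball_rpow _ h12p hL0, hYdef]; ring
      _ ≤ X + Y * ENNReal.ofReal (L ^ (1 - 2 * ρ)) := by
          gcongr X + Y * ENNReal.ofReal ?_
          exact Real.rpow_le_rpow_of_exponent_le hL1 hexp
  -- pass to the reals
  have hRHS : X + Y * ENNReal.ofReal (L ^ (1 - 2 * ρ)) ≠ ⊤ :=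
    ENNReal.add_ne_top.2 ⟨hXtop, ENNReal.mul_ne_top hYtop ENNReal.ofReal_ne_top⟩
  have hreal : ∫ y in ball (0 : EuclideanSpace ℝ (Fin 3)) L, ‖V y‖ ^ 2 ≤
      X.toReal + Y.toReal * L ^ (1 - 2 * ρ) := by
    rw [integral_ball_sq_eq_toReal hV2 L]
    refine (ENNReal.toReal_mono hRHS hsplit).trans (le_of_eq ?_)
    rw [ENNReal.toReal_add hXtop (ENNReal.mul_ne_top hYtop ENNReal.ofReal_ne_top),
      ENNReal.toReal_mul, ENNReal.toReal_ofReal (Real.rpow_nonneg hL0.le _)]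
  have hLpow : L ^ (2 * ρ - 1) * L ^ (1 - 2 * ρ) = 1 := by
    rw [← Real.rpow_add hL0]; norm_num
  have hLρ : 0 ≤ L ^ (2 * ρ - 1) := Real.rpow_nonneg hL0.le _
  calc L ^ (2 * ρ - 1) * ∫ y in ball (0 : EuclideanSpace ℝ (Fin 3)) L, ‖V y‖ ^ 2
      ≤ L ^ (2 * ρ - 1) * (X.toReal + Y.toReal * L ^ (1 - 2 * ρ)) :=
        mul_le_mul_of_nonneg_left hreal hLρ
    _ = L ^ (2 * ρ - 1) * X.toReal + Y.toReal * (L ^ (2 * ρ - 1) * L ^ (1 - 2 * ρ)) := by ring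
    _ = L ^ (2 * ρ - 1) * X.toReal + Y.toReal := by rw [hLpow, mul_one]
    _ < ε / 2 + ε / 2 := by
        refine add_lt_add (lt_of_le_of_lt ?_ hLX) hYreal
        exact mul_le_mul_of_nonneg_left (by linarith) hLρ
    _ = ε := by ring

/-- The profile lemma with a GLOBAL hypothesis `V ∈ L^p(ℝ³)` (then `|V|² ∈ L¹_loc` is automatic,
`p ≥ 2`). [cite: ChaeShvydkoy2013, §3.2 Thm. 3.2 (range `α ≤ N/p`)] -/
theorem subExtremal_of_memLp' {ρ p : ℝ} (hρ : 0 < ρ) (hρ2 : ρ < 1 / 2) (hp2 : 2 ≤ p)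
    (hp : p ≤ 3 / (1 + ρ)) (hVp : MemLp V (ENNReal.ofReal p) volume) :
    ∀ ε : ℝ, 0 < ε → ∀ L₀ : ℝ, ∃ L : ℝ, L₀ ≤ L ∧
      L ^ (2 * ρ - 1) * ∫ y in ball (0 : EuclideanSpace ℝ (Fin 3)) L, ‖V y‖ ^ 2 < ε := by
  have hVm : AEStronglyMeasurable V volume := hVp.aestronglyMeasurable
  have h2p : (2 : ℝ≥0∞) ≤ ENNReal.ofReal p := by
    rw [show (2 : ℝ≥0∞) = ENNReal.ofReal 2 by norm_num]; exact ENNReal.ofReal_le_ofReal hp2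
  -- `V ∈ L²_loc`
  have hV2 : LocallyIntegrable (fun y => ‖V y‖ ^ 2) volume := by
    intro x
    refine ⟨ball x 1, isOpen_ball.mem_nhds (mem_ball_self one_pos), ?_⟩
    haveI : IsFiniteMeasure (volume.restrict (ball x (1 : ℝ))) :=
      isFiniteMeasure_restrict.2 measure_ball_lt_top.ne
    have h2 : MemLp V 2 (volume.restrict (ball x 1)) := (hVp.restrict _).mono_exponent h2p
    exact (memLp_two_iff_integrable_sq_norm hVm.restrict).1 h2
  exact subExtremal_of_memLp (R₀ := 0) hρ hρ2 hp2 hp hVm hV2 (hVp.restrict _)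

end Profile

section Member

/-- **The `L^p`-profile stratum, centred** (crux hypotheses verbatim + exact self-similarity about the
origin, `0 < ρ < 1/2`): if the velocity profile lies in `L^q({|y| ≥ R₀})` for some
`2 ≤ q ≤ 3/(1+ρ)` (the easy side of Chae–Shvydkoy's `L^q` window, `α = 1+ρ ≤ 3/q`), the member is
trivial — by `subExtremal_of_memLp` the profile is sub-extremal, and sub-extremal exactly self-similar
members vanish (`EnergySaturation.selfSimilar_ae_eq_zero_of_subExtremal`).  No `C¹_loc`, no profile
hypothesis beyond the class. [cite: ChaeShvydkoy2013, §3.2 Thm. 3.2 (range `α ≤ N/p`)] -/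
theorem selfSimilar_ae_eq_zero_of_memLp_profile {ρ : ℝ} (hρ : 0 < ρ) (hρ2 : ρ < 1 / 2)
    {u : ℝ → EuclideanSpace ℝ (Fin 3) → EuclideanSpace ℝ (Fin 3)} {p : ℝ → EuclideanSpace ℝ (Fin 3) → ℝ}
    {H : ℝ → EuclideanSpace ℝ (Fin 3) → EuclideanSpace ℝ (Fin 3) →L[ℝ] EuclideanSpace ℝ (Fin 3)} {c : ℝ≥0}
    (hsw : IsSuitableWeakSolutionOn (slab (EuclideanSpace ℝ (Fin 3)) (Iio 0) isOpen_Iio) 0 0 u p)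
    (hH : HasWeakSpatialGradientOn (slab (EuclideanSpace ℝ (Fin 3)) (Iio 0) isOpen_Iio) u H)
    (hgauge : ∀ a : ℝ, 0 < a →
      ENNReal.ofReal (a ^ (2 * ρ)) * cknA a (0 : ℝ × EuclideanSpace ℝ (Fin 3)) u +
          ENNReal.ofReal (a ^ ρ) * cknE a (0 : ℝ × EuclideanSpace ℝ (Fin 3)) H +
        ENNReal.ofReal (a ^ (2 * ρ)) * cknD a (0 : ℝ × EuclideanSpace ℝ (Fin 3)) p ≤ (c : ℝ≥0∞))
    {V : EuclideanSpace ℝ (Fin 3) → EuclideanSpace ℝ (Fin 3)} {P : EuclideanSpace ℝ (Fin 3) → ℝ}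
    (hu : ∀ τ : ℝ, τ < 0 → u τ = selfSimilarCollapse (1 / (2 + ρ)) 0 V τ)
    (hp : ∀ τ : ℝ, τ < 0 → p τ = selfSimilarCollapsePressure (1 / (2 + ρ)) 0 P τ)
    {q R₀ : ℝ} (hq2 : 2 ≤ q) (hq : q ≤ 3 / (1 + ρ))
    (hVq : MemLp V (ENNReal.ofReal q) (volume.restrict {y : EuclideanSpace ℝ (Fin 3) | R₀ ≤ ‖y‖})) :
    uncurry u =ᵐ[volume.restrict (Iio (0 : ℝ) ×ˢ (univ : Set (EuclideanSpace ℝ (Fin 3))))] 0 := by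
  obtain ⟨G, -, hVm, -, -, -, hA, -⟩ := EnergySaturation.profileData_of_selfSimilar hρ (by linarith) hsw hH hgauge hu hp
  exact EnergySaturation.selfSimilar_ae_eq_zero_of_subExtremal hρ (by linarith) hsw hH hgauge hu hp
    (subExtremal_of_memLp hρ hρ2 hq2 hq hVm (EnergySaturation.locallyIntegrable_norm_sq_of_growth hVm hA) hVq)

/-- **The `L^p`-profile stratum, centred, global form**: `V ∈ L^q(ℝ³)`, `2 ≤ q ≤ 3/(1+ρ)`,
`0 < ρ < 1/2` ⇒ the member is trivial. [cite: ChaeShvydkoy2013, §3.2 Thm. 3.2 (range `α ≤ N/p`)] -/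
theorem selfSimilar_ae_eq_zero_of_memLp_profile' {ρ : ℝ} (hρ : 0 < ρ) (hρ2 : ρ < 1 / 2)
    {u : ℝ → EuclideanSpace ℝ (Fin 3) → EuclideanSpace ℝ (Fin 3)} {p : ℝ → EuclideanSpace ℝ (Fin 3) → ℝ}
    {H : ℝ → EuclideanSpace ℝ (Fin 3) → EuclideanSpace ℝ (Fin 3) →L[ℝ] EuclideanSpace ℝ (Fin 3)} {c : ℝ≥0}
    (hsw : IsSuitableWeakSolutionOn (slab (EuclideanSpace ℝ (Fin 3)) (Iio 0) isOpen_Iio) 0 0 u p)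
    (hH : HasWeakSpatialGradientOn (slab (EuclideanSpace ℝ (Fin 3)) (Iio 0) isOpen_Iio) u H)
    (hgauge : ∀ a : ℝ, 0 < a →
      ENNReal.ofReal (a ^ (2 * ρ)) * cknA a (0 : ℝ × EuclideanSpace ℝ (Fin 3)) u +
          ENNReal.ofReal (a ^ ρ) * cknE a (0 : ℝ × EuclideanSpace ℝ (Fin 3)) H +
        ENNReal.ofReal (a ^ (2 * ρ)) * cknD a (0 : ℝ × EuclideanSpace ℝ (Fin 3)) p ≤ (c : ℝ≥0∞))
    {V : EuclideanSpace ℝ (Fin 3) → EuclideanSpace ℝ (Fin 3)} {P : EuclideanSpace ℝ (Fin 3) → ℝ}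
    (hu : ∀ τ : ℝ, τ < 0 → u τ = selfSimilarCollapse (1 / (2 + ρ)) 0 V τ)
    (hp : ∀ τ : ℝ, τ < 0 → p τ = selfSimilarCollapsePressure (1 / (2 + ρ)) 0 P τ)
    {q : ℝ} (hq2 : 2 ≤ q) (hq : q ≤ 3 / (1 + ρ)) (hVq : MemLp V (ENNReal.ofReal q) volume) :
    uncurry u =ᵐ[volume.restrict (Iio (0 : ℝ) ×ˢ (univ : Set (EuclideanSpace ℝ (Fin 3))))] 0 :=
  EnergySaturation.selfSimilar_ae_eq_zero_of_subExtremal hρ (by linarith) hsw hH hgauge hu hp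
    (subExtremal_of_memLp' hρ hρ2 hq2 hq hVq)

/-- **The `L^p`-profile stratum, past/shifted** (crux hypotheses verbatim, `0 < ρ < 1/2`): a member that
is exactly self-similar about `(T, x₀)` on a past sub-slab `τ < T₁` (`T₁ ≤ 0`, `T₁ ≤ T`) — arbitrary
on `[T₁, 0)` — whose velocity profile lies in `L^q({|y| ≥ R₀})` for some `2 ≤ q ≤ 3/(1+ρ)` is trivial:
sub-extremal by `subExtremal_of_memLp`, then the large-scale chain
`Past.selfSimilar_ae_eq_zero_of_subExtremal_past`. [cite: ChaeShvydkoy2013, §3.2 Thm. 3.2 (range `α ≤ N/p`)] -/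
theorem selfSimilar_ae_eq_zero_of_memLp_profile_past {ρ : ℝ} (hρ : 0 < ρ) (hρ2 : ρ < 1 / 2)
    {T T₁ : ℝ} (hT₁ : T₁ ≤ 0) (hTT₁ : T₁ ≤ T) (x₀ : EuclideanSpace ℝ (Fin 3))
    {u : ℝ → EuclideanSpace ℝ (Fin 3) → EuclideanSpace ℝ (Fin 3)} {p : ℝ → EuclideanSpace ℝ (Fin 3) → ℝ}
    {H : ℝ → EuclideanSpace ℝ (Fin 3) → EuclideanSpace ℝ (Fin 3) →L[ℝ] EuclideanSpace ℝ (Fin 3)} {c : ℝ≥0}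
    (hsw : IsSuitableWeakSolutionOn (slab (EuclideanSpace ℝ (Fin 3)) (Iio 0) isOpen_Iio) 0 0 u p)
    (hH : HasWeakSpatialGradientOn (slab (EuclideanSpace ℝ (Fin 3)) (Iio 0) isOpen_Iio) u H)
    (hgauge : ∀ a : ℝ, 0 < a →
      ENNReal.ofReal (a ^ (2 * ρ)) * cknA a (0 : ℝ × EuclideanSpace ℝ (Fin 3)) u +
          ENNReal.ofReal (a ^ ρ) * cknE a (0 : ℝ × EuclideanSpace ℝ (Fin 3)) H +
        ENNReal.ofReal (a ^ (2 * ρ)) * cknD a (0 : ℝ × EuclideanSpace ℝ (Fin 3)) p ≤ (c : ℝ≥0∞))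
    {V : EuclideanSpace ℝ (Fin 3) → EuclideanSpace ℝ (Fin 3)} {P : EuclideanSpace ℝ (Fin 3) → ℝ}
    (hu : ∀ τ : ℝ, τ < T₁ → u τ = fun x => selfSimilarCollapse (1 / (2 + ρ)) T V τ (x - x₀))
    (hp : ∀ τ : ℝ, τ < T₁ → p τ = fun x => selfSimilarCollapsePressure (1 / (2 + ρ)) T P τ (x - x₀))
    {q R₀ : ℝ} (hq2 : 2 ≤ q) (hq : q ≤ 3 / (1 + ρ))
    (hVq : MemLp V (ENNReal.ofReal q) (volume.restrict {y : EuclideanSpace ℝ (Fin 3) | R₀ ≤ ‖y‖})) :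
    uncurry u =ᵐ[volume.restrict (Iio (0 : ℝ) ×ˢ (univ : Set (EuclideanSpace ℝ (Fin 3))))] 0 := by
  obtain ⟨G, c', hVm, -, -, -, hA₁, -⟩ :=
    Past.exists_locData_of_past hρ hρ2.le hT₁ hTT₁ x₀ hsw hH hgauge hu hp
  exact Past.selfSimilar_ae_eq_zero_of_subExtremal_past hρ hρ2.le hT₁ hTT₁ x₀ hsw hH hgauge hu hp
    (subExtremal_of_memLp hρ hρ2 hq2 hq hVm (EnergySaturation.locallyIntegrable_norm_sq_of_growth_loc hVm hA₁)
      hVq)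

/-- **The `L^p`-profile stratum, past/shifted, global form**: `V ∈ L^q(ℝ³)`, `2 ≤ q ≤ 3/(1+ρ)`,
`0 < ρ < 1/2` ⇒ the member is trivial. [cite: ChaeShvydkoy2013, §3.2 Thm. 3.2 (range `α ≤ N/p`)] -/
theorem selfSimilar_ae_eq_zero_of_memLp_profile_past' {ρ : ℝ} (hρ : 0 < ρ) (hρ2 : ρ < 1 / 2)
    {T T₁ : ℝ} (hT₁ : T₁ ≤ 0) (hTT₁ : T₁ ≤ T) (x₀ : EuclideanSpace ℝ (Fin 3))
    {u : ℝ → EuclideanSpace ℝ (Fin 3) → EuclideanSpace ℝ (Fin 3)} {p : ℝ → EuclideanSpace ℝ (Fin 3) → ℝ}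
    {H : ℝ → EuclideanSpace ℝ (Fin 3) → EuclideanSpace ℝ (Fin 3) →L[ℝ] EuclideanSpace ℝ (Fin 3)} {c : ℝ≥0}
    (hsw : IsSuitableWeakSolutionOn (slab (EuclideanSpace ℝ (Fin 3)) (Iio 0) isOpen_Iio) 0 0 u p)
    (hH : HasWeakSpatialGradientOn (slab (EuclideanSpace ℝ (Fin 3)) (Iio 0) isOpen_Iio) u H)
    (hgauge : ∀ a : ℝ, 0 < a →
      ENNReal.ofReal (a ^ (2 * ρ)) * cknA a (0 : ℝ × EuclideanSpace ℝ (Fin 3)) u +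
          ENNReal.ofReal (a ^ ρ) * cknE a (0 : ℝ × EuclideanSpace ℝ (Fin 3)) H +
        ENNReal.ofReal (a ^ (2 * ρ)) * cknD a (0 : ℝ × EuclideanSpace ℝ (Fin 3)) p ≤ (c : ℝ≥0∞))
    {V : EuclideanSpace ℝ (Fin 3) → EuclideanSpace ℝ (Fin 3)} {P : EuclideanSpace ℝ (Fin 3) → ℝ}
    (hu : ∀ τ : ℝ, τ < T₁ → u τ = fun x => selfSimilarCollapse (1 / (2 + ρ)) T V τ (x - x₀))
    (hp : ∀ τ : ℝ, τ < T₁ → p τ = fun x => selfSimilarCollapsePressure (1 / (2 + ρ)) T P τ (x - x₀))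
    {q : ℝ} (hq2 : 2 ≤ q) (hq : q ≤ 3 / (1 + ρ)) (hVq : MemLp V (ENNReal.ofReal q) volume) :
    uncurry u =ᵐ[volume.restrict (Iio (0 : ℝ) ×ˢ (univ : Set (EuclideanSpace ℝ (Fin 3))))] 0 :=
  Past.selfSimilar_ae_eq_zero_of_subExtremal_past hρ hρ2.le hT₁ hTT₁ x₀ hsw hH hgauge hu hp
    (subExtremal_of_memLp' hρ hρ2 hq2 hq hVq)

end Member

end LpProfile

end Summit.NavierStokesRegularity.NavierStokesRegularity.Theorems.PowerGaugeEulerLiouville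

end
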